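import Literature.Computability.Cryptography.RegevSamplerSubst
import HarnessLib

/-!
# Regev 2009, Lemma 3.14 in machine form: the standard sub-zone of the oracle's work wires

Topic `Literature/Computability/Cryptography`, grouping namespace `Regev2009.SamplerSubst`; sequel of
`RegevSamplerSubst.lean` and `RegevSamplerLayoutStd.lean`. The per-block machine theorems take the placement
`Z : SubZone Λ d` of the `kq + d` wires of the substituted `CVP` circuit (query copy and ancillas) off the zones, with
`base ≤ Z.dirt s`. This file gives the STANDARD SUB-ZONE: wire `s` at `base + s`, for any well-formed layout with room
`base + (kq + d) ≤ W`.

* `stdZone Λ hΛ hroom : SubZone Λ d`, `stdZone_dirt_val`, `base_le_stdZone_dirt`.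

Everything here is proved; no named fact is introduced.

## References

* O. Regev, *On lattices, learning with errors, random linear codes, and cryptography*, J. ACM 56 (2009),
  art. 34, Lemma 3.14 (proof: the oracle call of the sampler) [Regev2009].
-/

noncomputable section

namespace Literature.Computability.Cryptography

namespace Regev2009

namespace SamplerSubst

open SamplerClassical SamplerClassical.Layout

variable {W n : ℕ} (Λ : SamplerClassical.Layout W n) (hΛ : Λ.OK) {d : ℕ} (hroom : Λ.base + (Λ.kq + d) ≤ W)

/-- **The standard sub-zone**: the oracle's wires at `base, base+1, …`. [cite: Regev2009, Lemma 3.14 (proof)] -/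
def stdZone : SubZone Λ d where
  dirt := ⟨fun t => ⟨Λ.base + t, by have := t.2; omega⟩, fun t t' h => Fin.ext (by simpa using congrArg Fin.val h)⟩
  off := fun t i hi h => by
    have hlt := Layout.fin_lt_base hΛ hi
    have hv : (Λ.fin i : ℕ) = Λ.base + t := by rw [← h]; rfl
    omega

/-- Values of the standard sub-zone wires. [folklore] -/
theorem stdZone_dirt_val (t : Fin (Λ.kq + d)) : ((stdZone Λ hΛ hroom).dirt t : ℕ) = Λ.base + t := rfl

/-- The standard sub-zone lies in the work window. [folklore] -/
theorem base_le_stdZone_dirt (t : Fin (Λ.kq + d)) : Λ.base ≤ ((stdZone Λ hΛ hroom).dirt t : ℕ) := by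
  rw [stdZone_dirt_val]; omega

end SamplerSubst

end Regev2009

end Literature.Computability.Cryptography

end
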